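import Summits.QuantumFields.YangMills.Theorems.BalabanLadderIRTwistedSlabTreeLevelDefect
import HarnessLib

/-!
# The r-PORT of K23 by a LAPLACE SANDWICH: `β^{a}·W{r.ρ; ω^k, 1}(β) → κ_r^{−a}·C` for every faithful lattice representation `r` of `SU(N)`
# with one-plaquette Hessian ratio `κ_r` — the ONE statement of the T1-box chain where the representation enters

HELPER toward stub **T1** `TwistedSlabAnchor` (LINE `twisted-slab-continuity`, crux `IRcof` stmt-QuantumFields-26930, census row 43; pooled
prover ym-ir-line-pool-p3 g17 on director KEY №56 «r-port as ONE rescaling statement»; `--supports` the crux, `--as helper`).  Theorems only.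
In the K4→K39 programme (LEAD tsc-p1) the representation enters at exactly ONE theorem, K23 `tendsto_rpow_mul_twistedPartition_slab_euclidean`
(`∃ C > 0, β^{a}·W{fundamentalRep}(β; box) → C`, r-FREE exponent `a = 3·|sites|·dim 𝔰𝔲(N)∕2`); downstream everything is ρ-generic or divides
the doubled box's constant by the square of the box's (`a(2t) = 2a(t)`), so `C ↦ κ^{−a}C` CANCELS in THE NUMBER.  This file proves that
rescaling WITHOUT reopening the charts ∕ Hessians ∕ determinants of K4–K22:
* §1 ★ `tendsto_rpow_mul_integral_exp_of_local_ratio` — THE LAPLACE SANDWICH (pure analysis): `X` compact, `μ` finite, `f, g ≥ 0` continuous,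
  `{g = 0} ⊆ {f = 0}`, and for every `ε > 0` an open `U ⊇ {f = 0}` with `(1−ε)κ·f ≤ g ≤ (1+ε)κ·f` on `U`; then `β^{a}∫e^{−βf} → C` implies
  `β^{a}∫e^{−βg} → κ^{−a}·C` (pointwise `e^{−βg} ≤ e^{−(1−ε)κβf} + e^{−βη_g}`, `e^{−(1+ε)κβf} ≤ e^{−βg} + e^{−(1+ε)κβη_f}`, `β ↦ (1±ε)κβ`).
* §2 the one-plaquette ratio hypothesis **(Q)** (a hypothesis SHAPE written inline, no definition):
  `Tendsto (h ↦ (r.N − Re tr r.ρ h) ∕ (N − Re tr h)) (𝓝[≠] 1) (𝓝 κ)`; for the defining representation `κ = 1` (`hessianRatio_fundamental`);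
  in general `κ` = the Dynkin-index ratio (Schur on the simple `𝔰𝔲(N)`) — NOT proved here.
* §3 ★★ `tendsto_rpow_mul_twistedPartition_slab_rep` — K23 for every faithful `r : LatticeRep SU(N)` with (Q) at `κ > 0`:
  `∃ C > 0, β^{a}·W{fund}(β) → C ∧ β^{a}·W{r.ρ}(β) → κ^{−a}·C` (same box, same `a`; both exponents vanish exactly on twisted-flat configurations).
HONEST FRAMING: binder coverage of T1 in `r`, MODULO (Q); M4 (`∀L∃β₀ → ∃β₀∀L`) and general `G` (BFM) untouched; T1 0∕1; `IRcof` ∕ `IR` 0∕1;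
the Yang–Mills mass gap (Clay) is NOT proved; R4 = `BalabanLadder.UV` only.  References: 't Hooft, NPB 153 (1979) §5; Dembo–Zeitouni (1998)
Thm 4.3.1 (Laplace principle); Hasenpflug–Rudolf–Sprungk (2024) App. 4.1.
-/

set_option autoImplicit false

noncomputable section

open scoped Topology BigOperators
open MeasureTheory Filter Set Module
open Literature.MathematicalPhysics.QuantumFieldTheory Literature.MathematicalPhysics.QuantumLattice
open Literature.MathematicalPhysics.QuantumFieldTheory.Balaban1983to89
open Literature.Barriers.QuantumFields (re_trace_le_of_mem_unitaryGroup eq_one_of_re_trace_eq)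

namespace Summit.QuantumFields.YangMills.Cruxes.IRcof.TwistedSlab

/-! ## §1 The Laplace sandwich (abstract) -/

section Sandwich

variable {X : Type*} [TopologicalSpace X] [CompactSpace X] [MeasurableSpace X] [OpensMeasurableSpace X]
  {μ : Measure X} [IsFiniteMeasure μ]

omit [MeasurableSpace X] [OpensMeasurableSpace X] in
/-- A continuous function that is positive on a closed subset of a compact space is bounded below there by a positive constant
(the empty set included). [folklore] -/
theorem exists_pos_forall_le_of_isClosed {f : X → ℝ} (hf : Continuous f) {K : Set X} (hK : IsClosed K)
    (hpos : ∀ x ∈ K, 0 < f x) : ∃ η : ℝ, 0 < η ∧ ∀ x ∈ K, η ≤ f x := by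
  rcases K.eq_empty_or_nonempty with hKe | hKne
  · exact ⟨1, one_pos, fun x hx => by simp [hKe] at hx⟩
  · obtain ⟨x₀, hx₀, hmin⟩ := hK.isCompact.exists_isMinOn hKne hf.continuousOn
    exact ⟨f x₀, hpos x₀ hx₀, fun x hx => (isMinOn_iff.1 hmin) x hx⟩

omit [TopologicalSpace X] [CompactSpace X] [MeasurableSpace X] [OpensMeasurableSpace X] in
/-- Pointwise upper sandwich: if `(1−ε)κ·f ≤ g` on `U` and `η ≤ g` off `U`, then for `β ≥ 0`
`e^{−β g(x)} ≤ e^{−(1−ε)κβ·f(x)} + e^{−β η}` everywhere. [folklore] -/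
theorem exp_neg_mul_le_of_lower_ratio {f g : X → ℝ} {U : Set X} {κ ε β η : ℝ} (hβ : 0 ≤ β)
    (hU : ∀ x ∈ U, (1 - ε) * κ * f x ≤ g x) (hUc : ∀ x, x ∉ U → η ≤ g x) (x : X) :
    Real.exp (-β * g x) ≤ Real.exp (-((1 - ε) * κ * β) * f x) + Real.exp (-β * η) := by
  by_cases hx : x ∈ U
  · have h1 : Real.exp (-β * g x) ≤ Real.exp (-((1 - ε) * κ * β) * f x) := by
      refine Real.exp_le_exp.2 ?_
      have := mul_le_mul_of_nonneg_left (hU x hx) hβ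
      nlinarith
    linarith [Real.exp_pos (-β * η)]
  · have h1 : Real.exp (-β * g x) ≤ Real.exp (-β * η) :=
      Real.exp_le_exp.2 (by nlinarith [hUc x hx])
    linarith [Real.exp_pos (-((1 - ε) * κ * β) * f x)]

omit [TopologicalSpace X] [CompactSpace X] [MeasurableSpace X] [OpensMeasurableSpace X] in
/-- Pointwise lower sandwich: if `g ≤ (1+ε)κ·f` on `U` and `η ≤ f` off `U`, then for `(1+ε)κβ ≥ 0`
`e^{−(1+ε)κβ·f(x)} ≤ e^{−β g(x)} + e^{−(1+ε)κβ·η}` everywhere. [folklore] -/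
theorem exp_neg_mul_le_of_upper_ratio {f g : X → ℝ} {U : Set X} {κ ε β η : ℝ} (hβ : 0 ≤ β) (hc : 0 ≤ (1 + ε) * κ * β)
    (hU : ∀ x ∈ U, g x ≤ (1 + ε) * κ * f x) (hUc : ∀ x, x ∉ U → η ≤ f x) (x : X) :
    Real.exp (-((1 + ε) * κ * β) * f x) ≤ Real.exp (-β * g x) + Real.exp (-((1 + ε) * κ * β) * η) := by
  by_cases hx : x ∈ U
  · have h1 : Real.exp (-((1 + ε) * κ * β) * f x) ≤ Real.exp (-β * g x) := by
      refine Real.exp_le_exp.2 ?_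
      have := mul_le_mul_of_nonneg_left (hU x hx) hβ
      nlinarith
    linarith [Real.exp_pos (-((1 + ε) * κ * β) * η)]
  · have h1 : Real.exp (-((1 + ε) * κ * β) * f x) ≤ Real.exp (-((1 + ε) * κ * β) * η) :=
      Real.exp_le_exp.2 (by nlinarith [hUc x hx])
    linarith [Real.exp_pos (-β * g x)]

/-- `x ↦ e^{−c·φ(x)}` is integrable for continuous `φ` (compact space, finite measure). [folklore] -/
theorem integrable_exp_neg_mul_comp {φ : X → ℝ} (hφ : Continuous φ) (c : ℝ) :
    Integrable (fun x => Real.exp (-c * φ x)) μ :=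
  (Real.continuous_exp.comp (continuous_const.mul hφ)).integrable_of_hasCompactSupport (HasCompactSupport.of_compactSpace _)

/-- Integrated upper sandwich: `∫ e^{−βg} ≤ ∫ e^{−(1−ε)κβ·f} + μ(X)·e^{−βη}`. [folklore] -/
theorem integral_exp_neg_mul_le_of_lower_ratio {f g : X → ℝ} (hf : Continuous f) (hg : Continuous g) {U : Set X}
    {κ ε β η : ℝ} (hβ : 0 ≤ β) (hU : ∀ x ∈ U, (1 - ε) * κ * f x ≤ g x) (hUc : ∀ x, x ∉ U → η ≤ g x) :
    ∫ x, Real.exp (-β * g x) ∂μ ≤ ∫ x, Real.exp (-((1 - ε) * κ * β) * f x) ∂μ + (μ univ).toReal * Real.exp (-β * η) := by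
  calc ∫ x, Real.exp (-β * g x) ∂μ
      ≤ ∫ x, (Real.exp (-((1 - ε) * κ * β) * f x) + Real.exp (-β * η)) ∂μ :=
        integral_mono (integrable_exp_neg_mul_comp hg β)
          ((integrable_exp_neg_mul_comp hf _).add (integrable_const _))
          (fun x => exp_neg_mul_le_of_lower_ratio hβ hU hUc x)
    _ = ∫ x, Real.exp (-((1 - ε) * κ * β) * f x) ∂μ + (μ univ).toReal * Real.exp (-β * η) := by
        rw [integral_add (integrable_exp_neg_mul_comp hf _) (integrable_const _), integral_const, smul_eq_mul,
          Measure.real]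

/-- Integrated lower sandwich: `∫ e^{−(1+ε)κβ·f} ≤ ∫ e^{−βg} + μ(X)·e^{−(1+ε)κβ·η}`. [folklore] -/
theorem integral_exp_neg_mul_le_of_upper_ratio {f g : X → ℝ} (hf : Continuous f) (hg : Continuous g) {U : Set X}
    {κ ε β η : ℝ} (hβ : 0 ≤ β) (hc : 0 ≤ (1 + ε) * κ * β) (hU : ∀ x ∈ U, g x ≤ (1 + ε) * κ * f x)
    (hUc : ∀ x, x ∉ U → η ≤ f x) :
    ∫ x, Real.exp (-((1 + ε) * κ * β) * f x) ∂μ ≤ ∫ x, Real.exp (-β * g x) ∂μ + (μ univ).toReal * Real.exp (-((1 + ε) * κ * β) * η) := by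
  calc ∫ x, Real.exp (-((1 + ε) * κ * β) * f x) ∂μ
      ≤ ∫ x, (Real.exp (-β * g x) + Real.exp (-((1 + ε) * κ * β) * η)) ∂μ :=
        integral_mono (integrable_exp_neg_mul_comp hf _)
          ((integrable_exp_neg_mul_comp hg β).add (integrable_const _))
          (fun x => exp_neg_mul_le_of_upper_ratio hβ hc hU hUc x)
    _ = ∫ x, Real.exp (-β * g x) ∂μ + (μ univ).toReal * Real.exp (-((1 + ε) * κ * β) * η) := by
        rw [integral_add (integrable_exp_neg_mul_comp hg _) (integrable_const _), integral_const, smul_eq_mul,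
          Measure.real]

/-- Rescaling a Laplace limit: `β^{a}·F(β) → C` implies `β^{a}·F(cβ) → c^{−a}·C` for `c > 0`. [folklore] -/
theorem tendsto_rpow_mul_comp_mul {F : ℝ → ℝ} {a C c : ℝ} (hc : 0 < c)
    (h : Tendsto (fun β : ℝ => β ^ a * F β) atTop (𝓝 C)) :
    Tendsto (fun β : ℝ => β ^ a * F (c * β)) atTop (𝓝 (c ^ (-a) * C)) := by
  have h1 : Tendsto (fun β : ℝ => (c * β) ^ a * F (c * β)) atTop (𝓝 C) := h.comp (tendsto_id.const_mul_atTop hc)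
  refine (h1.const_mul (c ^ (-a))).congr' ?_
  filter_upwards [eventually_gt_atTop (0 : ℝ)] with β hβ
  rw [Real.mul_rpow hc.le hβ.le, ← mul_assoc, ← mul_assoc, Real.rpow_neg hc.le,
    inv_mul_cancel₀ (Real.rpow_pos_of_pos hc a).ne', one_mul]

/-- The boundary terms are negligible: `β^{a}·(m·e^{−β η}) → 0` for `η > 0`. [folklore] -/
theorem tendsto_rpow_mul_const_mul_exp_neg {a : ℝ} (m : ℝ) {η : ℝ} (hη : 0 < η) :
    Tendsto (fun β : ℝ => β ^ a * (m * Real.exp (-β * η))) atTop (𝓝 0) := by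
  have h := (tendsto_rpow_mul_exp_neg_mul_atTop_nhds_zero a η hη).const_mul m
  rw [mul_zero] at h
  refine h.congr' (Eventually.of_forall fun β => ?_)
  have : -β * η = -η * β := by ring
  simp only [this]
  ring

/-- A small positive `ε` with a prescribed strict inequality that holds at `ε = 0` and depends continuously on `ε`. [folklore] -/
theorem exists_pos_lt_of_continuousAt {φ : ℝ → ℝ} (hφ : ContinuousAt φ 0) {b : ℝ} (hb : b < φ 0) {δ : ℝ} (hδ : 0 < δ) :
    ∃ ε : ℝ, 0 < ε ∧ ε < δ ∧ b < φ ε := by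
  have hev : ∀ᶠ ε in 𝓝 (0 : ℝ), b < φ ε := hφ.eventually (eventually_gt_nhds hb)
  have hev' : ∀ᶠ ε in 𝓝[>] (0 : ℝ), (b < φ ε ∧ ε < δ) ∧ ε ∈ Ioi (0 : ℝ) :=
    ((hev.and (eventually_lt_nhds hδ)).filter_mono nhdsWithin_le_nhds).and eventually_mem_nhdsWithin
  obtain ⟨ε, ⟨hεb, hεδ⟩, hε0⟩ := hev'.exists
  exact ⟨ε, hε0, hεδ, hεb⟩

/-- ★ **THE LAPLACE SANDWICH.**  `X` compact, `μ` finite; `f, g ≥ 0` continuous with `{g = 0} ⊆ {f = 0}`; `κ > 0`; for every `ε > 0` an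
open `U ⊇ {f = 0}` with `(1−ε)κ·f ≤ g ≤ (1+ε)κ·f` on `U`.  Then `β^{a}·∫e^{−βf}dμ → C` implies `β^{a}·∫e^{−βg}dμ → κ^{−a}·C`: the local ratio
of the exponents at the zero set rescales the Laplace constant by `κ^{−a}`. [cite: HasenpflugRudolfSprungk2024, App. 4.1] [folklore] -/
theorem tendsto_rpow_mul_integral_exp_of_local_ratio {f g : X → ℝ} (hf : Continuous f) (hg : Continuous g)
    (hf0 : ∀ x, 0 ≤ f x) (hg0 : ∀ x, 0 ≤ g x) (hgf : ∀ x, g x = 0 → f x = 0) {κ : ℝ} (hκ : 0 < κ)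
    (hloc : ∀ ε : ℝ, 0 < ε → ∃ U : Set X, IsOpen U ∧ (∀ x, f x = 0 → x ∈ U) ∧
      ∀ x ∈ U, (1 - ε) * κ * f x ≤ g x ∧ g x ≤ (1 + ε) * κ * f x)
    {a C : ℝ} (h : Tendsto (fun β : ℝ => β ^ a * ∫ x, Real.exp (-β * f x) ∂μ) atTop (𝓝 C)) :
    Tendsto (fun β : ℝ => β ^ a * ∫ x, Real.exp (-β * g x) ∂μ) atTop (𝓝 (κ ^ (-a) * C)) := by
  set m : ℝ := (μ univ).toReal with hm
  -- positive minima off an open set containing the zero sets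
  have hmin : ∀ U : Set X, IsOpen U → (∀ x, f x = 0 → x ∈ U) →
      (∃ ηf : ℝ, 0 < ηf ∧ ∀ x, x ∉ U → ηf ≤ f x) ∧ (∃ ηg : ℝ, 0 < ηg ∧ ∀ x, x ∉ U → ηg ≤ g x) := by
    intro U hU hZ
    have hK : IsClosed Uᶜ := hU.isClosed_compl
    refine ⟨?_, ?_⟩
    · obtain ⟨η, hη, hle⟩ := exists_pos_forall_le_of_isClosed hf hK fun x hx =>
        lt_of_le_of_ne (hf0 x) fun h0 => hx (hZ x h0.symm)
      exact ⟨η, hη, fun x hx => hle x hx⟩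
    · obtain ⟨η, hη, hle⟩ := exists_pos_forall_le_of_isClosed hg hK fun x hx =>
        lt_of_le_of_ne (hg0 x) fun h0 => hx (hZ x (hgf x h0.symm))
      exact ⟨η, hη, fun x hx => hle x hx⟩
  have hκa : ∀ {c : ℝ}, 0 < c → ContinuousAt (fun ε : ℝ => (c + ε * κ) ^ (-a) * C) 0 := fun {c} hc => by
    have h1 : ContinuousAt (fun ε : ℝ => c + ε * κ) 0 := by fun_prop
    exact (h1.rpow_const (Or.inl (by simp [hc.ne']))).mul continuousAt_const
  rw [tendsto_order]
  refine ⟨fun b hb => ?_, fun b hb => ?_⟩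
  · -- LOWER BOUND: eventually `b < β^a ∫ e^{−βg}`
    -- an `ε > 0` with `b < ((1+ε)κ)^{−a}·C`
    obtain ⟨ε, hε0, -, hεb⟩ := exists_pos_lt_of_continuousAt (hκa hκ) (b := b) (by simpa using hb) one_pos
    have hcp : 0 < (1 + ε) * κ := by positivity
    have hεb' : b < ((1 + ε) * κ) ^ (-a) * C := by
      have : κ + ε * κ = (1 + ε) * κ := by ring
      simpa [this] using hεb
    obtain ⟨U, hUo, hZU, hU⟩ := hloc ε hε0
    obtain ⟨⟨ηf, hηf, hηfU⟩, -⟩ := hmin U hUo hZU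
    -- the comparison `β^a W_f((1+ε)κβ) − β^a m e^{−(1+ε)κβ ηf} ≤ β^a W_g(β)` and its limit
    have hlim : Tendsto (fun β : ℝ => β ^ a * ∫ x, Real.exp (-((1 + ε) * κ * β) * f x) ∂μ -
        β ^ a * (m * Real.exp (-β * ((1 + ε) * κ * ηf)))) atTop (𝓝 (((1 + ε) * κ) ^ (-a) * C - 0)) :=
      (tendsto_rpow_mul_comp_mul (F := fun β => ∫ x, Real.exp (-β * f x) ∂μ) hcp h).sub
        (tendsto_rpow_mul_const_mul_exp_neg m (by positivity))
    rw [sub_zero] at hlim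
    filter_upwards [hlim.eventually_const_lt hεb', eventually_ge_atTop (0 : ℝ)] with β hβ hβ0
    refine lt_of_lt_of_le hβ ?_
    have hβa : 0 ≤ β ^ a := Real.rpow_nonneg hβ0 a
    have hint := integral_exp_neg_mul_le_of_upper_ratio (μ := μ) hf hg hβ0 (by positivity) (fun x hx => (hU x hx).2) hηfU
      (κ := κ) (ε := ε) (β := β)
    have hrw : -β * ((1 + ε) * κ * ηf) = -((1 + ε) * κ * β) * ηf := by ring
    rw [hrw, ← hm] at *
    nlinarith [mul_le_mul_of_nonneg_left hint hβa]
  · -- UPPER BOUND: eventually `β^a ∫ e^{−βg} < b`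
    -- an `ε ∈ (0, 1)` with `((1−ε)κ)^{−a}·C < b`
    have hb' : -b < (κ + 0 * (-κ)) ^ (-a) * (-C) := by
      have : -b < κ ^ (-a) * (-C) := by linarith
      simpa using this
    have hcont : ContinuousAt (fun ε : ℝ => (κ + ε * (-κ)) ^ (-a) * (-C)) 0 := by
      have h1 : ContinuousAt (fun ε : ℝ => κ + ε * (-κ)) 0 := by fun_prop
      exact (h1.rpow_const (Or.inl (by simp [hκ.ne']))).mul continuousAt_const
    obtain ⟨ε, hε0, hε1, hεb⟩ := exists_pos_lt_of_continuousAt hcont hb' one_pos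
    have hcm : 0 < (1 - ε) * κ := by nlinarith
    have hεb' : ((1 - ε) * κ) ^ (-a) * C < b := by
      have : κ + ε * (-κ) = (1 - ε) * κ := by ring
      rw [this] at hεb
      linarith
    obtain ⟨U, hUo, hZU, hU⟩ := hloc ε hε0
    obtain ⟨-, ⟨ηg, hηg, hηgU⟩⟩ := hmin U hUo hZU
    have hlim : Tendsto (fun β : ℝ => β ^ a * ∫ x, Real.exp (-((1 - ε) * κ * β) * f x) ∂μ +
        β ^ a * (m * Real.exp (-β * ηg))) atTop (𝓝 (((1 - ε) * κ) ^ (-a) * C + 0)) :=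
      (tendsto_rpow_mul_comp_mul (F := fun β => ∫ x, Real.exp (-β * f x) ∂μ) hcm h).add
        (tendsto_rpow_mul_const_mul_exp_neg m hηg)
    rw [add_zero] at hlim
    filter_upwards [hlim.eventually_lt_const hεb', eventually_ge_atTop (0 : ℝ)] with β hβ hβ0
    refine lt_of_le_of_lt ?_ hβ
    have hβa : 0 ≤ β ^ a := Real.rpow_nonneg hβ0 a
    have hint := integral_exp_neg_mul_le_of_lower_ratio (μ := μ) hf hg hβ0 (fun x hx => (hU x hx).1) hηgU
      (κ := κ) (ε := ε)
    rw [← hm] at hint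
    nlinarith [mul_le_mul_of_nonneg_left hint hβa]

end Sandwich

/-! ## §2 The one-plaquette Hessian ratio (Q) `Tendsto (h ↦ (r.N − Re tr r.ρ h) ∕ (N − Re tr h)) (𝓝[≠] 1) (𝓝 κ)` — a HYPOTHESIS SHAPE
(no definition, no fact; `κ` = Dynkin-index ratio by Schur on the simple `𝔰𝔲(N)`, NOT proved here; `κ = 1` for the defining `r`) -/

section Ratio

variable {N : ℕ}

/-- From (Q): for every `ε > 0` an OPEN neighbourhood `V ∋ 1` in `SU(N)` on which
`(1−ε)κ·(N − Re tr h) ≤ r.N − Re tr r.ρ(h) ≤ (1+ε)κ·(N − Re tr h)` (at `h = 1` both sides vanish). [folklore] -/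
theorem exists_open_ratio_bounds_of_hessianRatio {r : LatticeRep (Matrix.specialUnitaryGroup (Fin N) ℂ)} {κ : ℝ}
    (hκ : 0 < κ)
    (hQ : Tendsto (fun h : Matrix.specialUnitaryGroup (Fin N) ℂ =>
      ((r.N : ℝ) - (r.ρ h).trace.re) / ((N : ℝ) - (fundamentalRep (Fin N) h).trace.re)) (𝓝[≠] 1) (𝓝 κ))
    {ε : ℝ} (hε : 0 < ε) :
    ∃ V : Set (Matrix.specialUnitaryGroup (Fin N) ℂ), IsOpen V ∧ (1 : Matrix.specialUnitaryGroup (Fin N) ℂ) ∈ V ∧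
      ∀ h ∈ V, (1 - ε) * κ * ((N : ℝ) - (fundamentalRep (Fin N) h).trace.re) ≤ (r.N : ℝ) - (r.ρ h).trace.re ∧
        (r.N : ℝ) - (r.ρ h).trace.re ≤ (1 + ε) * κ * ((N : ℝ) - (fundamentalRep (Fin N) h).trace.re) := by
  have hlo : (1 - ε) * κ < κ := by nlinarith
  have hhi : κ < (1 + ε) * κ := by nlinarith
  have hev : ∀ᶠ h in 𝓝[≠] (1 : Matrix.specialUnitaryGroup (Fin N) ℂ),
      (1 - ε) * κ < ((r.N : ℝ) - (r.ρ h).trace.re) / ((N : ℝ) - (fundamentalRep (Fin N) h).trace.re) ∧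
        ((r.N : ℝ) - (r.ρ h).trace.re) / ((N : ℝ) - (fundamentalRep (Fin N) h).trace.re) < (1 + ε) * κ :=
    (hQ.eventually_const_lt hlo).and (hQ.eventually_lt_const hhi)
  rw [eventually_nhdsWithin_iff] at hev
  obtain ⟨V, hVsub, hVo, h1V⟩ := mem_nhds_iff.1 hev
  refine ⟨V, hVo, h1V, fun h hh => ?_⟩
  have hφ0 : 0 ≤ (N : ℝ) - (fundamentalRep (Fin N) h).trace.re :=
    sub_nonneg.2 (re_trace_le_of_mem_unitaryGroup (fundamentalRep_mem_unitaryGroup h))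
  by_cases h1 : h = 1
  · subst h1
    have hf : (N : ℝ) - (fundamentalRep (Fin N) 1).trace.re = 0 := by
      rw [map_one, Matrix.trace_one]; simp
    have hg : (r.N : ℝ) - (r.ρ 1).trace.re = 0 := by
      rw [map_one, Matrix.trace_one]; simp
    rw [hf, hg]; simp
  · have hpos : 0 < (N : ℝ) - (fundamentalRep (Fin N) h).trace.re := by
      refine lt_of_le_of_ne hφ0 fun h0 => h1 ?_
      have htr : (fundamentalRep (Fin N) h).trace.re = N := by linarith
      have h1' : fundamentalRep (Fin N) h = 1 := eq_one_of_re_trace_eq (fundamentalRep_mem_unitaryGroup h) htr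
      exact fundamentalRep_injective (Fin N) (by rw [h1', map_one])
    obtain ⟨hl, hu⟩ := hVsub hh h1
    rw [lt_div_iff₀ hpos] at hl
    rw [div_lt_iff₀ hpos] at hu
    exact ⟨hl.le, hu.le⟩

end Ratio

/-! ## §3 K23 for every faithful lattice representation of `SU(N)` with a Hessian ratio -/

section Rep

open scoped Matrix.Norms.L2Operator

variable {N : ℕ} {m m₂ m₃ : ℕ}

/-- The tensor-twisted action of a box in the representation `ρ` (written inline, as in `…ClassicalRate`): an abbreviation local to
this file's statements. [cite: tHooft1979Flux, §2 (2.6)] -/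
theorem wilsonFinTorusTensorTwistedPartition_eq_integral {M : ℕ} (ρ : Matrix.specialUnitaryGroup (Fin N) ℂ →* Matrix (Fin M) (Fin M) ℂ)
    (β : ℝ) (w : Fin 4 → Fin 4 → Matrix.specialUnitaryGroup (Fin N) ℂ) (n₀ n₁ n₂ n₃ : ℕ) :
    wilsonFinTorusTensorTwistedPartition ρ β w n₀ n₁ n₂ n₃ =
      ∫ U : FinTorusSite n₀ n₁ n₂ n₃ × Fin 4 → Matrix.specialUnitaryGroup (Fin N) ℂ,
        Real.exp (-β * ∑ x : FinTorusSite n₀ n₁ n₂ n₃, ∑ q : {q : Fin 4 × Fin 4 // q.1 < q.2},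
          ((M : ℝ) - (ρ (tHooftTwistTensor w x q.1.1 q.1.2 * finTorusPlaquette U x q.1.1 q.1.2)).trace.re))
        ∂(Measure.pi fun _ => haarProbability (Matrix.specialUnitaryGroup (Fin N) ℂ)) := rfl

/-- **Zero action is twisted-flatness, hence representation-independent**: if the `r.ρ`-action of a configuration vanishes then so does
its action in the defining representation (faithful unitary `r`). [folklore] -/
theorem twistedAction_fundamental_eq_zero_of_rep_eq_zero (r : LatticeRep (Matrix.specialUnitaryGroup (Fin N) ℂ))
    (w : Fin 4 → Fin 4 → Matrix.specialUnitaryGroup (Fin N) ℂ) {n₀ n₁ n₂ n₃ : ℕ}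
    (U : FinTorusSite n₀ n₁ n₂ n₃ × Fin 4 → Matrix.specialUnitaryGroup (Fin N) ℂ)
    (h0 : ∑ x : FinTorusSite n₀ n₁ n₂ n₃, ∑ q : {q : Fin 4 × Fin 4 // q.1 < q.2},
      ((r.N : ℝ) - (r.ρ (tHooftTwistTensor w x q.1.1 q.1.2 * finTorusPlaquette U x q.1.1 q.1.2)).trace.re) = 0) :
    ∑ x : FinTorusSite n₀ n₁ n₂ n₃, ∑ q : {q : Fin 4 × Fin 4 // q.1 < q.2},
      ((N : ℝ) - (fundamentalRep (Fin N) (tHooftTwistTensor w x q.1.1 q.1.2 * finTorusPlaquette U x q.1.1 q.1.2)).trace.re) = 0 := by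
  have hflat := twistedFlat_of_twistedAction_eq_zero r.mem_unitary r.injective w U h0
  refine Finset.sum_eq_zero fun x _ => Finset.sum_eq_zero fun q _ => ?_
  rw [hflat x q.1.1 q.1.2 q.2, map_one, Matrix.trace_one]
  simp

/-- The open set of configurations all of whose twisted plaquettes lie in an open `V ∋ 1` is open and contains every configuration of
zero action in the defining representation. [folklore] -/
theorem isOpen_setOf_forall_twistedPlaquette_mem {V : Set (Matrix.specialUnitaryGroup (Fin N) ℂ)} (hV : IsOpen V)
    (w : Fin 4 → Fin 4 → Matrix.specialUnitaryGroup (Fin N) ℂ) (n₀ n₁ n₂ n₃ : ℕ) :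
    IsOpen {U : FinTorusSite n₀ n₁ n₂ n₃ × Fin 4 → Matrix.specialUnitaryGroup (Fin N) ℂ |
      ∀ (x : FinTorusSite n₀ n₁ n₂ n₃) (q : {q : Fin 4 × Fin 4 // q.1 < q.2}),
        tHooftTwistTensor w x q.1.1 q.1.2 * finTorusPlaquette U x q.1.1 q.1.2 ∈ V} := by
  have hU : ∀ l : FinTorusSite n₀ n₁ n₂ n₃ × Fin 4,
      Continuous fun U : FinTorusSite n₀ n₁ n₂ n₃ × Fin 4 → Matrix.specialUnitaryGroup (Fin N) ℂ => U l :=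
    fun l => continuous_apply l
  have hpl : ∀ (x : FinTorusSite n₀ n₁ n₂ n₃) (μ ν : Fin 4),
      Continuous fun U : FinTorusSite n₀ n₁ n₂ n₃ × Fin 4 → Matrix.specialUnitaryGroup (Fin N) ℂ =>
        tHooftTwistTensor w x μ ν * finTorusPlaquette U x μ ν := fun x μ ν =>
    continuous_const.mul ((((hU _).mul (hU _)).mul (hU _).inv).mul (hU _).inv)
  have : {U : FinTorusSite n₀ n₁ n₂ n₃ × Fin 4 → Matrix.specialUnitaryGroup (Fin N) ℂ |
      ∀ (x : FinTorusSite n₀ n₁ n₂ n₃) (q : {q : Fin 4 × Fin 4 // q.1 < q.2}),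
        tHooftTwistTensor w x q.1.1 q.1.2 * finTorusPlaquette U x q.1.1 q.1.2 ∈ V} =
      ⋂ x : FinTorusSite n₀ n₁ n₂ n₃, ⋂ q : {q : Fin 4 × Fin 4 // q.1 < q.2},
        (fun U => tHooftTwistTensor w x q.1.1 q.1.2 * finTorusPlaquette U x q.1.1 q.1.2) ⁻¹' V := by
    ext U; simp
  rw [this]
  exact isOpen_iInter_of_finite fun x => isOpen_iInter_of_finite fun q => hV.preimage (hpl x _ _)

/-- ★★ **K23 FOR EVERY FAITHFUL LATTICE REPRESENTATION OF `SU(N)` WITH A HESSIAN RATIO** (the r-port of the ONE r-dependent statement of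
the T1-box chain): `N ≥ 2`, `k` a unit, box `(m+1)² × (m₂+1) × (m₃+1)`, `r : LatticeRep SU(N)`, `κ > 0` with (Q).  With K23's r-free exponent `a`
and K23's constant `C > 0`: `β^{a}·W{fundamentalRep; ω^k·1, 1}(β) → C` AND `β^{a}·W{r.ρ; ω^k·1, 1}(β) → κ^{−a}·C` (Laplace sandwich on the
product-Haar configuration space; both exponents vanish exactly on twisted-flat configurations; (Q) pinches their ratio plaquette-wise).
[cite: tHooft1979Flux, §5] [cite: HasenpflugRudolfSprungk2024, App. 4.1 Thm 16] -/
theorem tendsto_rpow_mul_twistedPartition_slab_rep [NeZero N] (hN : 2 ≤ N) {k : ZMod N} (hk : IsUnit k)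
    (r : LatticeRep (Matrix.specialUnitaryGroup (Fin N) ℂ)) {κ : ℝ} (hκ : 0 < κ)
    (hQ : Tendsto (fun h : Matrix.specialUnitaryGroup (Fin N) ℂ =>
      ((r.N : ℝ) - (r.ρ h).trace.re) / ((N : ℝ) - (fundamentalRep (Fin N) h).trace.re)) (𝓝[≠] 1) (𝓝 κ)) :
    ∃ C : ℝ, 0 < C ∧
      Tendsto (fun β : ℝ =>
        β ^ ((3 * ((m + 1) * (m + 1) * (m₂ + 1) * (m₃ + 1) * finrank ℝ (specialUnitaryLogChart (Fin N)).lie) : ℕ) / 2 : ℝ) *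
          wilsonFinTorusTensorTwistedPartition (fundamentalRep (Fin N)) β (slabTwist (suCenter N k : Matrix.specialUnitaryGroup (Fin N) ℂ) 1)
            (m + 1) (m + 1) (m₂ + 1) (m₃ + 1)) atTop (𝓝 C) ∧
      Tendsto (fun β : ℝ =>
        β ^ ((3 * ((m + 1) * (m + 1) * (m₂ + 1) * (m₃ + 1) * finrank ℝ (specialUnitaryLogChart (Fin N)).lie) : ℕ) / 2 : ℝ) *
          wilsonFinTorusTensorTwistedPartition r.ρ β (slabTwist (suCenter N k : Matrix.specialUnitaryGroup (Fin N) ℂ) 1)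
            (m + 1) (m + 1) (m₂ + 1) (m₃ + 1)) atTop
        (𝓝 (κ ^ (-((3 * ((m + 1) * (m + 1) * (m₂ + 1) * (m₃ + 1) * finrank ℝ (specialUnitaryLogChart (Fin N)).lie) : ℕ) / 2 : ℝ)) * C)) := by
  obtain ⟨C, hC, hlim⟩ := tendsto_rpow_mul_twistedPartition_slab_euclidean (m := m) (m₂ := m₂) (m₃ := m₃) hN hk
  refine ⟨C, hC, hlim, ?_⟩
  set w : Fin 4 → Fin 4 → Matrix.specialUnitaryGroup (Fin N) ℂ := slabTwist (suCenter N k : Matrix.specialUnitaryGroup (Fin N) ℂ) 1 with hw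
  -- the two exponents
  set f : (FinTorusSite (m + 1) (m + 1) (m₂ + 1) (m₃ + 1) × Fin 4 → Matrix.specialUnitaryGroup (Fin N) ℂ) → ℝ := fun U =>
    ∑ x : FinTorusSite (m + 1) (m + 1) (m₂ + 1) (m₃ + 1), ∑ q : {q : Fin 4 × Fin 4 // q.1 < q.2},
      ((N : ℝ) - (fundamentalRep (Fin N) (tHooftTwistTensor w x q.1.1 q.1.2 * finTorusPlaquette U x q.1.1 q.1.2)).trace.re) with hf
  set g : (FinTorusSite (m + 1) (m + 1) (m₂ + 1) (m₃ + 1) × Fin 4 → Matrix.specialUnitaryGroup (Fin N) ℂ) → ℝ := fun U =>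
    ∑ x : FinTorusSite (m + 1) (m + 1) (m₂ + 1) (m₃ + 1), ∑ q : {q : Fin 4 × Fin 4 // q.1 < q.2},
      ((r.N : ℝ) - (r.ρ (tHooftTwistTensor w x q.1.1 q.1.2 * finTorusPlaquette U x q.1.1 q.1.2)).trace.re) with hg
  have hfc : Continuous f := continuous_twistedAction (continuous_fundamentalRep (Fin N)) w
  have hgc : Continuous g := continuous_twistedAction r.continuous w
  have hf0 : ∀ U, 0 ≤ f U := fun U => twistedAction_nonneg fundamentalRep_mem_unitaryGroup w U
  have hg0 : ∀ U, 0 ≤ g U := fun U => twistedAction_nonneg r.mem_unitary w U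
  have hgf : ∀ U, g U = 0 → f U = 0 := fun U hU => twistedAction_fundamental_eq_zero_of_rep_eq_zero r w U hU
  -- the local ratio from (Q), plaquette by plaquette
  have hloc : ∀ ε : ℝ, 0 < ε → ∃ Uo : Set (FinTorusSite (m + 1) (m + 1) (m₂ + 1) (m₃ + 1) × Fin 4 → Matrix.specialUnitaryGroup (Fin N) ℂ),
      IsOpen Uo ∧ (∀ U, f U = 0 → U ∈ Uo) ∧ ∀ U ∈ Uo, (1 - ε) * κ * f U ≤ g U ∧ g U ≤ (1 + ε) * κ * f U := by
    intro ε hε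
    obtain ⟨V, hVo, h1V, hV⟩ := exists_open_ratio_bounds_of_hessianRatio hκ hQ hε
    refine ⟨{U | ∀ (x : FinTorusSite (m + 1) (m + 1) (m₂ + 1) (m₃ + 1)) (q : {q : Fin 4 × Fin 4 // q.1 < q.2}),
      tHooftTwistTensor w x q.1.1 q.1.2 * finTorusPlaquette U x q.1.1 q.1.2 ∈ V},
      isOpen_setOf_forall_twistedPlaquette_mem hVo w _ _ _ _, fun U hU x q => ?_, fun U hU => ⟨?_, ?_⟩⟩
    · -- zero action ⇒ every twisted plaquette is `1 ∈ V`
      have hflat := twistedFlat_of_twistedAction_eq_zero fundamentalRep_mem_unitaryGroup (fundamentalRep_injective (Fin N)) w U hU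
      rw [hflat x q.1.1 q.1.2 q.2]
      exact h1V
    · rw [hf, hg, Finset.mul_sum]
      refine Finset.sum_le_sum fun x _ => ?_
      rw [Finset.mul_sum]
      exact Finset.sum_le_sum fun q _ => (hV _ (hU x q)).1
    · rw [hf, hg, Finset.mul_sum]
      refine Finset.sum_le_sum fun x _ => ?_
      rw [Finset.mul_sum]
      exact Finset.sum_le_sum fun q _ => (hV _ (hU x q)).2
  -- the sandwich
  have h := tendsto_rpow_mul_integral_exp_of_local_ratio
    (μ := Measure.pi fun _ : FinTorusSite (m + 1) (m + 1) (m₂ + 1) (m₃ + 1) × Fin 4 =>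
      haarProbability (Matrix.specialUnitaryGroup (Fin N) ℂ))
    hfc hgc hf0 hg0 hgf hκ hloc (by simpa only [wilsonFinTorusTensorTwistedPartition_eq_integral] using hlim)
  simpa only [wilsonFinTorusTensorTwistedPartition_eq_integral] using h

end Rep

end Summit.QuantumFields.YangMills.Cruxes.IRcof.TwistedSlab

end
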